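import Literature.Dynamics.Hyperbolic.HyperbolicSemiflowModelTransit
import Literature.Dynamics.Hyperbolic.SemiflowPoincareMap

/-!
# Smoothness of the quantitative transit time: the uniform `C²` Poincaré-map package along `Λ`

Topic `Literature/Dynamics/Hyperbolic`.  Fully proved theorems (no definitions, no named facts), the sequel of
`HyperbolicSemiflowModelTransit.lean` (`IsHyperbolicSemiflowModel.exists_transitTime_lipschitz`: along a `C²` local semiflow model
`h : IsHyperbolicSemiflowModel U Λ g m` the transit time `τ` from `ball x₀ (α/C)²`, `x₀ ∈ Λ`, to the section `{z | ℓ (z − g 1 x₀) = 0}`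
of transversality `α ≤ ℓ (flowDir g (g 1 x₀))`, `‖ℓ‖ ≤ 1`, exists with ONE constant `C` for all of `Λ`, and `τ`, `y ↦ g (τ y) y` are
`(C/α)`-Lipschitz).  Here this `τ` is shown to be `C²`, with the derivative formulas, so that the whole transit-time / Poincaré-map
package of `SemiflowPoincareMap.lean` holds on the EXPLICIT ball `ball x₀ (α/C)²` — uniformly over the sets
`{x₀ ∈ Λ : ℓ (flowDir g (g 1 x₀)) ≥ α}` with no compactness argument (block D5 of the closing lemma `stub_ambientClosing` of the
Navier–Stokes line `ergodic-budget-selection-closing`, `Summits/AnomalousDissipation`, in its uniform form):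

* §1 `contDiffOn_transitTime_of_continuousOn` — GLUING: for `g` jointly `Cⁿ` on an open `W ⊆ ℝ × E` (`E` complete), a CONTINUOUS
  function `τ` on an open `V` with `(τ y, y) ∈ W`, `ℓ (g (τ y) y) = c` (a fixed section) and `ℓ (∂ₜ g (τ y, y)) ≠ 0` (transversality
  along the graph) is `Cⁿ` on `V` — it agrees near each point with the implicit-function transit time of
  `exists_contDiffOn_transitTime` by the uniqueness window of the latter; `fderiv_transitTime_poincareMap_of_contDiffOn` — the
  derivative formulas `D τ = −(ℓ ∂ₜ g)⁻¹ • ℓ ∘ D₂ g`, `D P = D₂ g + D τ ⊗ ∂ₜ g` at every point of `V` for such a `Cⁿ` transit time.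
* §2 `IsHyperbolicSemiflowModel.exists_transitTime_contDiffOn` — the package of `exists_transitTime_lipschitz` (same constant `C`,
  same clauses) PLUS: `τ` and the Poincaré map `P y = g (τ y) y` are `C²` on `ball x₀ (α/C)²`, and at every point `y` of that ball
  `ℓ (∂ₜ g (τ y, y)) ≥ α/2`, the two derivative formulas hold, and `‖D τ (y)‖, ‖D P (y)‖ ≤ C/α`.
* §3 `exists_forall_norm_flowDir_sub_lt`, `exists_forall_sub_le_apply_flowDir` — uniform continuity of the flow direction on `Λ`
  and its consequence `ℓ (flowDir g x') ≥ ℓ (flowDir g x) − α` for `x' ∈ Λ` `δ(α)`-close to `x ∈ Λ`, `‖ℓ‖ ≤ 1`: at a `δ`-RETURN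
  `g n x₀ ≈ x₀` the section through `x₀` is still `α`-transversal at `g n x₀`, so the last Poincaré map of a closing chain may be taken
  from the base point `g (n−1) x₀` straight to the INITIAL section (no section change, no `t → 0` holonomy).

## References

* A. Katok, *Lyapunov exponents, entropy and periodic orbits for diffeomorphisms*, Publ. Math. IHÉS 51 (1980) 137–173, §3. [Katok1980]
* Z. Lian, L.-S. Young, *Lyapunov exponents, periodic orbits, and horseshoes for semiflows on Hilbert spaces*, J. Amer. Math. Soc. 25
  (2012) 637–665, §1. [LianYoung2012]
* D. Henry, *Geometric Theory of Semilinear Parabolic Equations*, LNM 840 (1981), Ch. 8 (Poincaré maps of semiflows). [Henry1981]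
-/

noncomputable section

open Set Function Metric Filter
open scoped Topology ContDiff NNReal

namespace Literature.Dynamics.Hyperbolic

/-! ## §1 Gluing: a continuous transit time to a fixed transversal section is smooth -/

section Gluing

variable {E : Type*} [NormedAddCommGroup E] [NormedSpace ℝ E]

/-- **A continuous transit time is as smooth as the semiflow.**  Let `g : ℝ → E → E` be jointly `Cⁿ` on an open `W` (`E` complete,
`n ≠ 0, ∞`), `V ⊆ E` open, and `τ : E → ℝ` CONTINUOUS on `V` with `(τ y, y) ∈ W`, `ℓ (g (τ y) y) = c` (the orbit of `y` is on the fixed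
affine section `{ℓ = c}` at time `τ y`) and `ℓ (∂ₜ g (τ y, y)) ≠ 0` (transversality) for all `y ∈ V`.  Then `τ` is `Cⁿ` on `V`: near each
`y ∈ V` it coincides with the implicit-function transit time through `(τ y, y)`, by continuity and the uniqueness window. [folklore] -/
theorem contDiffOn_transitTime_of_continuousOn [CompleteSpace E] {n : WithTop ℕ∞} (hn : n ≠ 0) (hn' : n ≠ ∞)
    {g : ℝ → E → E} {W : Set (ℝ × E)} (hWo : IsOpen W) (hg : ContDiffOn ℝ n (fun q : ℝ × E => g q.1 q.2) W)
    {V : Set E} (hV : IsOpen V) {τ : E → ℝ} (hτc : ContinuousOn τ V) (hτW : ∀ y ∈ V, (τ y, y) ∈ W)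
    {ℓ : E →L[ℝ] ℝ} {c : ℝ} (hsec : ∀ y ∈ V, ℓ (g (τ y) y) = c) (htr : ∀ y ∈ V, ℓ (deriv (fun t => g t y) (τ y)) ≠ 0) :
    ContDiffOn ℝ n τ V := by
  intro y hy
  have hWy : W ∈ 𝓝 (τ y, y) := hWo.mem_nhds (hτW y hy)
  obtain ⟨ε, hε, η, hη, τ', hτ'cd, -, -, hτ'uniq⟩ :=
    exists_contDiffOn_transitTime hn hn' hWy (hg.contDiffAt hWy) (htr y hy)
  have hVy : V ∈ 𝓝 y := hV.mem_nhds hy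
  have hwin : ∀ᶠ z in 𝓝 y, τ z ∈ Ioo (τ y - η) (τ y + η) :=
    hτc.continuousAt hVy (Ioo_mem_nhds (by linarith) (by linarith))
  have heq : τ =ᶠ[𝓝 y] τ' := by
    filter_upwards [hVy, ball_mem_nhds y hε, hwin] with z hzV hzb hzw
    refine hτ'uniq z hzb (τ z) hzw ?_
    rw [map_sub, hsec z hzV, hsec y hy, sub_self]
  exact ((hτ'cd.contDiffAt (ball_mem_nhds y hε)).congr_of_eventuallyEq heq).contDiffWithinAt

/-- **Derivative formulas for a smooth transit time to a fixed section.**  If `g` is jointly `Cⁿ` on the open `W` (`n ≠ 0`), `τ` is `Cⁿ`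
on the open `V` with `(τ y, y) ∈ W`, `ℓ (g (τ y) y) = c` and `ℓ (∂ₜ g (τ y, y)) ≠ 0` on `V`, then at every `y ∈ V`:
`D τ (y) = −(ℓ (∂ₜ g))⁻¹ • ℓ ∘ D₂ g` and `D P (y) = D₂ g + D τ (y) ⊗ ∂ₜ g` for the Poincaré map `P z = g (τ z) z`, with
`∂ₜ g = deriv (fun t => g t y) (τ y)`, `D₂ g = fderiv ℝ (g (τ y)) y`. [folklore] -/
theorem fderiv_transitTime_poincareMap_of_contDiffOn {n : WithTop ℕ∞} (hn : n ≠ 0)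
    {g : ℝ → E → E} {W : Set (ℝ × E)} (hWo : IsOpen W) (hg : ContDiffOn ℝ n (fun q : ℝ × E => g q.1 q.2) W)
    {V : Set E} (hV : IsOpen V) {τ : E → ℝ} (hτ : ContDiffOn ℝ n τ V) (hτW : ∀ y ∈ V, (τ y, y) ∈ W)
    {ℓ : E →L[ℝ] ℝ} {c : ℝ} (hsec : ∀ y ∈ V, ℓ (g (τ y) y) = c) (htr : ∀ y ∈ V, ℓ (deriv (fun t => g t y) (τ y)) ≠ 0)
    {y : E} (hy : y ∈ V) :
    fderiv ℝ τ y = -(ℓ (deriv (fun t => g t y) (τ y)))⁻¹ • ℓ.comp (fderiv ℝ (g (τ y)) y) ∧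
      fderiv ℝ (fun z => g (τ z) z) y = fderiv ℝ (g (τ y)) y + (fderiv ℝ τ y).smulRight (deriv (fun t => g t y) (τ y)) := by
  have hWy : W ∈ 𝓝 (τ y, y) := hWo.mem_nhds (hτW y hy)
  have hAy := ((hg.contDiffAt hWy).differentiableAt hn).hasFDerivAt
  have hτy : HasFDerivAt τ (fderiv ℝ τ y) y := ((hτ.contDiffAt (hV.mem_nhds hy)).differentiableAt hn).hasFDerivAt
  have hsec' : ∀ᶠ z in 𝓝 y, ℓ (g (τ z) z - g (τ y) y) = 0 := by
    filter_upwards [hV.mem_nhds hy] with z hz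
    rw [map_sub, hsec z hz, hsec y hy, sub_self]
  have hdy : deriv (fun t => g t y) (τ y) = fderiv ℝ (fun q : ℝ × E => g q.1 q.2) (τ y, y) (1, 0) := deriv_time_eq hAy
  have hℓy : ℓ (fderiv ℝ (fun q : ℝ × E => g q.1 q.2) (τ y, y) (1, 0)) ≠ 0 := by rw [← hdy]; exact htr y hy
  refine ⟨?_, ?_⟩
  · rw [hdy, fderiv_space_eq hAy]; exact fderiv_transitTime_eq hAy hτy hsec' hℓy
  · rw [hdy, fderiv_space_eq hAy]; exact (hasFDerivAt_poincareMap hAy hτy).fderiv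

end Gluing

/-! ## §2 The uniform `C²` package along `Λ` -/

namespace IsHyperbolicSemiflowModel

section Smooth

variable {E : Type*} [NormedAddCommGroup E] [NormedSpace ℝ E] [MeasurableSpace E] [CompleteSpace E]
  {U Λ : Set E} {g : ℝ → E → E} {m : MeasureTheory.Measure E}

/-- **The uniform `C²` transit-time / Poincaré-map package along `Λ` (block D5, uniform form).**  Let `E` be complete.  There is a
constant `C ≥ 1` such that for every `x₀ ∈ Λ`, every functional `‖ℓ‖ ≤ 1` and every `0 < α ≤ ℓ (flowDir g (g 1 x₀))`, with
`s = α / C ≤ 1/4` and `B = ball x₀ s²`: the conclusions of `exists_transitTime_lipschitz` hold (transversality `≥ α/2` on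
`[1 − s, 1 + s] × B` inside `(0,2) × U`; `(t, y) ↦ g t y` is `C`-Lipschitz there; a transit time `τ`, `τ x₀ = 1`, valued in `(1 − s, 1 + s)`,
to the section `{z | ℓ (z − g 1 x₀) = 0}`, with `|τ y − 1| ≤ (C/α) dist y x₀`, the quantitative uniqueness `(α/2)|t − τ y| ≤ |ℓ (g t y − g 1 x₀)|`,
and `τ`, `P = (y ↦ g (τ y) y)` `(C/α)`-Lipschitz on `B`), AND: `τ`, `P` are `C²` on `B`, and at every `y ∈ B` the section is transversal at
`P y` (`ℓ (∂ₜ g (τ y, y)) ≥ α/2`), `D τ (y) = −(ℓ ∂ₜ g)⁻¹ • ℓ ∘ D₂ g`, `D P (y) = D₂ g + D τ (y) ⊗ ∂ₜ g`, `‖D τ (y)‖ ≤ C/α`, `‖D P (y)‖ ≤ C/α`.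
[folklore] -/
theorem exists_transitTime_contDiffOn (h : IsHyperbolicSemiflowModel U Λ g m) :
    ∃ C : ℝ, 1 ≤ C ∧ ∀ x₀ ∈ Λ, ∀ ℓ : E →L[ℝ] ℝ, ‖ℓ‖ ≤ 1 → ∀ α : ℝ, 0 < α → α ≤ ℓ (flowDir g (g 1 x₀)) →
      α / C ≤ 1 / 4 ∧
      (∀ y : E, dist y x₀ < (α / C) ^ 2 → ∀ t ∈ Icc (1 - α / C) (1 + α / C),
        (t, y) ∈ Ioo (0 : ℝ) 2 ×ˢ U ∧ α / 2 ≤ ℓ (fderiv ℝ (fun p : ℝ × E => g p.1 p.2) (t, y) (1, 0))) ∧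
      (∀ y y' : E, dist y x₀ < (α / C) ^ 2 → dist y' x₀ < (α / C) ^ 2 →
        ∀ t ∈ Icc (1 - α / C) (1 + α / C), ∀ t' ∈ Icc (1 - α / C) (1 + α / C),
          dist (g t y) (g t' y') ≤ C * (|t - t'| + dist y y')) ∧
      ∃ τ : E → ℝ, τ x₀ = 1 ∧
        (∀ y : E, dist y x₀ < (α / C) ^ 2 →
          τ y ∈ Ioo (1 - α / C) (1 + α / C) ∧ ℓ (g (τ y) y - g 1 x₀) = 0 ∧ |τ y - 1| ≤ C / α * dist y x₀) ∧
        (∀ y : E, dist y x₀ < (α / C) ^ 2 → ∀ t ∈ Icc (1 - α / C) (1 + α / C),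
          α / 2 * |t - τ y| ≤ |ℓ (g t y - g 1 x₀)|) ∧
        (∀ y y' : E, dist y x₀ < (α / C) ^ 2 → dist y' x₀ < (α / C) ^ 2 →
          |τ y - τ y'| ≤ C / α * dist y y' ∧ dist (g (τ y) y) (g (τ y') y') ≤ C / α * dist y y') ∧
        ContDiffOn ℝ 2 τ (ball x₀ ((α / C) ^ 2)) ∧ ContDiffOn ℝ 2 (fun y => g (τ y) y) (ball x₀ ((α / C) ^ 2)) ∧
        ∀ y ∈ ball x₀ ((α / C) ^ 2),
          α / 2 ≤ ℓ (deriv (fun t => g t y) (τ y)) ∧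
          fderiv ℝ τ y = -(ℓ (deriv (fun t => g t y) (τ y)))⁻¹ • ℓ.comp (fderiv ℝ (g (τ y)) y) ∧
          fderiv ℝ (fun z => g (τ z) z) y =
            fderiv ℝ (g (τ y)) y + (fderiv ℝ τ y).smulRight (deriv (fun t => g t y) (τ y)) ∧
          ‖fderiv ℝ τ y‖ ≤ C / α ∧ ‖fderiv ℝ (fun z => g (τ z) z) y‖ ≤ C / α := by
  obtain ⟨C, hC1, hP⟩ := h.exists_transitTime_lipschitz
  refine ⟨C, hC1, fun x₀ hx₀ ℓ hℓ α hα hαℓ => ?_⟩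
  obtain ⟨hs4, hbox, hlip, τ, hτ0, hτsec, hτuniq, hτlip⟩ := hP x₀ hx₀ ℓ hℓ α hα hαℓ
  have hW : IsOpen (Ioo (0 : ℝ) 2 ×ˢ U) := isOpen_Ioo.prod h.isOpen
  have hCα : 0 ≤ C / α := div_nonneg (by linarith) hα.le
  set V : Set E := ball x₀ ((α / C) ^ 2) with hV
  have hmemV : ∀ y ∈ V, dist y x₀ < (α / C) ^ 2 := fun y hy => mem_ball.1 hy
  have hτwin : ∀ y ∈ V, τ y ∈ Icc (1 - α / C) (1 + α / C) := fun y hy => Ioo_subset_Icc_self (hτsec y (hmemV y hy)).1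
  have hτW : ∀ y ∈ V, (τ y, y) ∈ Ioo (0 : ℝ) 2 ×ˢ U := fun y hy => (hbox y (hmemV y hy) (τ y) (hτwin y hy)).1
  have hdτ : ∀ y ∈ V, deriv (fun t => g t y) (τ y) = fderiv ℝ (fun p : ℝ × E => g p.1 p.2) (τ y, y) (1, 0) := fun y hy =>
    (h.hasDerivAt_orbit (hτW y hy).2 (hτW y hy).1).deriv
  have htr' : ∀ y ∈ V, α / 2 ≤ ℓ (deriv (fun t => g t y) (τ y)) := fun y hy => by
    rw [hdτ y hy]; exact (hbox y (hmemV y hy) (τ y) (hτwin y hy)).2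
  have htr : ∀ y ∈ V, ℓ (deriv (fun t => g t y) (τ y)) ≠ 0 := fun y hy => ((half_pos hα).trans_le (htr' y hy)).ne'
  have hsec : ∀ y ∈ V, ℓ (g (τ y) y) = ℓ (g 1 x₀) := fun y hy => by
    have h1 := (hτsec y (hmemV y hy)).2.1
    rwa [map_sub, sub_eq_zero] at h1
  -- Lipschitz packages of `τ` and `P` on `V`
  have hKτ : LipschitzOnWith (Real.toNNReal (C / α)) τ V := LipschitzOnWith.of_dist_le_mul fun z hz y hy => by
    rw [Real.coe_toNNReal _ hCα, Real.dist_eq]; exact (hτlip z y (hmemV z hz) (hmemV y hy)).1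
  have hKP : LipschitzOnWith (Real.toNNReal (C / α)) (fun y => g (τ y) y) V := LipschitzOnWith.of_dist_le_mul fun z hz y hy => by
    rw [Real.coe_toNNReal _ hCα]; exact (hτlip z y (hmemV z hz) (hmemV y hy)).2
  have hcd : ContDiffOn ℝ 2 τ V :=
    contDiffOn_transitTime_of_continuousOn (n := 2) (by norm_num) (by decide) hW h.contDiffOn isOpen_ball hKτ.continuousOn
      hτW hsec htr
  have hPcd : ContDiffOn ℝ 2 (fun y => g (τ y) y) V :=
    contDiffOn_poincareMap hcd fun y hy => h.contDiffOn.contDiffAt (hW.mem_nhds (hτW y hy))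
  refine ⟨hs4, hbox, hlip, τ, hτ0, hτsec, hτuniq, hτlip, hcd, hPcd, fun y hy => ?_⟩
  obtain ⟨hf1, hf2⟩ := fderiv_transitTime_poincareMap_of_contDiffOn (n := 2) (by norm_num) hW h.contDiffOn isOpen_ball hcd
    hτW hsec htr hy
  refine ⟨htr' y hy, hf1, hf2, ?_, ?_⟩
  · have h1 := norm_fderiv_le_of_lipschitzOn ℝ (isOpen_ball.mem_nhds hy) hKτ
    rwa [Real.coe_toNNReal _ hCα] at h1
  · have h1 := norm_fderiv_le_of_lipschitzOn ℝ (isOpen_ball.mem_nhds hy) hKP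
    rwa [Real.coe_toNNReal _ hCα] at h1

end Smooth

/-! ## §3 Transversality at a near return (the last-step section change of the closing lemma) -/

section Return

variable {E : Type*} [NormedAddCommGroup E] [NormedSpace ℝ E] [MeasurableSpace E]
  {U Λ : Set E} {g : ℝ → E → E} {m : MeasureTheory.Measure E}

/-- **The flow direction is uniformly continuous on `Λ`**: for `ε > 0` there is `δ > 0` with `‖flowDir g x' − flowDir g x‖ < ε` for
`x, x' ∈ Λ`, `dist x' x < δ` (continuity of `flowDir g` on the compact `Λ`). [folklore] -/
theorem exists_forall_norm_flowDir_sub_lt (h : IsHyperbolicSemiflowModel U Λ g m) {ε : ℝ} (hε : 0 < ε) :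
    ∃ δ > 0, ∀ x ∈ Λ, ∀ x' ∈ Λ, dist x' x < δ → ‖flowDir g x' - flowDir g x‖ < ε := by
  obtain ⟨δ, hδ, hc⟩ := exists_forall_dist_lt_of_continuousOn h.continuousOn_flowDir h.isCompact Subset.rfl hε
  exact ⟨δ, hδ, fun x hx x' hx' hd => by rw [← dist_eq_norm]; exact hc x hx x' hx' hd⟩

/-- **Transversality persists at a near return, quantitatively.**  For `α > 0` there is `δ > 0` such that for `x, x' ∈ Λ` with
`dist x' x < δ` and every functional `‖ℓ‖ ≤ 1`: `ℓ (flowDir g x') ≥ ℓ (flowDir g x) − α`.  Use (closing lemma, last step): if the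
section functional `ℓ` at the initial point `x = x₀` has `ℓ (flowDir g x₀) ≥ 2α` and the orbit returns at time `n` to `x' = g n x₀`
within `δ` of `x₀`, then `ℓ (flowDir g (g 1 (g (n-1) x₀))) ≥ α`, so `exists_transitTime_lipschitz` / `exists_transitTime_contDiffOn`
apply at the base point `g (n-1) x₀` with the functional of the INITIAL section and transversality `α` — the Poincaré map of the last
step lands directly on the section through `x₀`. [folklore] -/
theorem exists_forall_sub_le_apply_flowDir (h : IsHyperbolicSemiflowModel U Λ g m) {α : ℝ} (hα : 0 < α) :
    ∃ δ > 0, ∀ x ∈ Λ, ∀ x' ∈ Λ, dist x' x < δ → ∀ ℓ : E →L[ℝ] ℝ, ‖ℓ‖ ≤ 1 → ℓ (flowDir g x) - α ≤ ℓ (flowDir g x') := by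
  obtain ⟨δ, hδ, hc⟩ := h.exists_forall_norm_flowDir_sub_lt hα
  refine ⟨δ, hδ, fun x hx x' hx' hd ℓ hℓ => ?_⟩
  have h1 : ℓ (flowDir g x) - ℓ (flowDir g x') ≤ α :=
    calc ℓ (flowDir g x) - ℓ (flowDir g x') = ℓ (flowDir g x - flowDir g x') := (map_sub ℓ _ _).symm
      _ ≤ ‖ℓ (flowDir g x - flowDir g x')‖ := Real.le_norm_self _
      _ ≤ ‖ℓ‖ * ‖flowDir g x - flowDir g x'‖ := ℓ.le_opNorm _
      _ ≤ 1 * α := mul_le_mul hℓ (by rw [norm_sub_rev]; exact (hc x hx x' hx' hd).le) (norm_nonneg _) zero_le_one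
      _ = α := one_mul α
  linarith

end Return

end IsHyperbolicSemiflowModel

end Literature.Dynamics.Hyperbolic

end
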